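import Mathlib
import HarnessLib
import Summits.PneNP.PneNP.Theses.AeaCutRectangles
import Summits.PneNP.PneNP.Theorems.AeaCutRectanglesDutyRectangles
import Summits.PneNP.PneNP.Theorems.AeaCutRectanglesDutyTransport
import Summits.PneNP.PneNP.Theorems.AeaCutRectanglesSparseWitnesses
import Summits.PneNP.PneNP.Theorems.AeaCutRectanglesNoSparseSupports
import Summits.PneNP.PneNP.Theorems.AeaCutRectanglesCriticalSupport
import Summits.PneNP.PneNP.Theorems.FoolingMeasure.Negative.FoolingMeasureFalseOfHalfSparseCore
import Summits.PneNP.PneNP.Cruxes.FoolingMeasure.NormalCycleSystems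

/-!
# Crux `FoolingMeasure` (stmt-PneNP-19727) / kill path `NoFoolingMeasure` (stmt-PneNP-19729) — p4 g13:
# the TYPE FLOOR as a theorem — few bisection-robust 4-critical types kill X1

Lens «barrier inversion, typed just outside the class», applied at crux level, KILL side; the "next line" after g12
(`ImpliedAtomCore.lean`: implied-atom certificates, false in substance on the half-dense critical (HDC) circulants —
BarrierNotesP4g12 §4: every certificate LANGUAGE that reads a subgraph / an implied pair / a co-implied pair needs all of
`G[B]` on an edge-critical, unfrozen half).  g12 §6.1(b) named the honest residue of the kill path: a FEW-TYPES structure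
theorem.  This file types it and proves the implication.

THE BARRIER (all landed kills of X1-candidates).  `foolingMeasure_false_for_sparseHalf` / `…_of_halfSparseCore`
(subgraph certificates: dead on HDC graphs, `not_halfSparseCore_of_hdCritical`), `…_for_orbitMeasures` (one isomorphism
type), `…_for_nonColourableSide` (one-sided), g12's atom cores.  Just OUTSIDE all of them sits one statement about the
class of graphs none of them certifies: the BISECTION-ROBUST 4-edge-critical edge sets (`BisectionRobustCritical`: edge-
critical, and every vertex set of size `≥ n/2` spans MORE than `n/2` edges).  The only such graphs known are the
Dobrynin–Mel'nikov–Pyatkin circulants (`C(12025; …)`, `C(2419; …)`; crux dir `RoundingDefectCertificate.lean`), and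
circulants on `n` points come in `≤ 2^n` isomorphism types.

THE STATEMENT TYPED HERE.  `RobustTypeBound T`: for every `n`, some list of `≤ T n` edge sets over `Fin n` contains, up
to relabelling (`relabel σ`), every bisection-robust 4-edge-critical edge set.  THEOREM
`foolingMeasure_false_of_fewRobustTypes`: `RobustTypeBound T → (∀ᶠ n, T n ≤ 2^{κ n}) → ¬ FoolingMeasure`, and the kill-
path link `noFoolingMeasure_of_fewRobustTypes`.  MECHANISM (`one_le_cover_bound`, a finite core valid for every `n ≥ 2`
and every probability measure obeying X1's clause with bound `δ` at the cuts of size `⌈n/2⌉`):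
`1 ≤ (2^n·(n/2+1)·C(N,n/2) + |𝓣|·n^{⌈n/2⌉})·δ`.  Every support graph `S` has an edge-critical core `F ⊆ S`
(`core`); EITHER `F` has a half-sparse near-half — then `S` lies in the Bob-superset rectangle of `(B, F[B])`,
`|B| = ⌈n/2⌉`, `|F[B]| ≤ n/2` (the `HalfSparseCore` rectangles of Theorems/FoolingMeasure/Negative, verbatim) — OR `F`
is bisection-robust, hence `F = relabel σ H` with `H ∈ 𝓣`, and `S` lies in the Bob-superset rectangle of
`(B⋆, F[B⋆])` for the FIXED cut `B⋆ = {v : v < ⌈n/2⌉}`; the key count (`bobSide_relabel_eq_typeBob`,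
`card_typeDuties_le`) is that `F[B⋆]` is determined by `H` and the restriction of `σ⁻¹` to `B⋆`, so the robust members
generate `≤ |𝓣|·n^{|B⋆|}` duties — the p558168 orbit count, now for an ARBITRARY measure.  With `|𝓣| ≤ 2^{κn}` and
`C = κ + 5` the right-hand side is `< 2^{-n} + n·2^{-5n} < 1`.

COROLLARIES.  (i) `robustTypeBound_zero_of_halfSparseCore`: `HalfSparseCore → RobustTypeBound 0`, so this theorem
GENERALISES the g2 conditional kill `foolingMeasure_false_of_halfSparseCore` — and unlike `HalfSparseCore` its
hypothesis survives the HDC circulants (few types).  (ii) Contrapositive, the construct side's burden as a theorem: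
X1 ⇒ for every `κ`, infinitely many `n` carry MORE than `2^{κn}` pairwise non-isomorphic bisection-robust 4-edge-critical
graphs (`foolingMeasure_imp_manyRobustTypes`).  The same proof with `B⋆` of size `⌈(1/2-ε)n⌉` gives the Stirling-scale
floor `#types ≥ n^{εn}·2^{Cn}` of IDEATION-CENSUS-r2s1g19 §2.1 (not typed here: one more layer of real-exponent
bookkeeping, same combinatorics).

§5 records, as a two-line Lean corollary, an ERRATUM for the crux record (memo BarrierNotesP4g13.md §3): a NORMAL cycle
system (crux dir `NormalCycleSystems.lean`, `CycleSystem.Normal`) that is dark is 4-edge-critical (`normal_fourCritical`),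
so its Alice side at ANY cut with an inside edge is 3-colourable (`normal_aliceSide_colorable`) — the "48–75 % dark Alice
sides of random normal systems" of RESULTS-r2s2g11 §1.4 bis (kit j315246) are therefore measurements on systems that are
NOT `Normal` (the generator enforced frame-bichromaticity, not the jump-`≡ 2` ORDER condition), and LAW (z′)/(z″) of card
`cores-not-systems` do not apply to the normal-cycle-system species.  (Its fate is decided elsewhere: seat-1 g20's
matching-threshold readout, card `matching-threshold-readout`.)

HONEST FRAMING.  Elementary counting over the tree's duty-rectangle engine; a conditional refutation of X1 / conditional
proof of the kill-path item modulo an OPEN finite-graph-theory statement (are there few bisection-robust 4-critical graphs?);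
FRONTIER material for a rung of Fagin's complement ladder (NON-3-COL vs ESO(∃*∀∃∀)).  Nothing here bears on P vs NP.
-/

set_option linter.dupNamespace false
set_option autoImplicit false

namespace Summit.PneNP.PneNP.Cruxes.FoolingMeasure.P4g13

open Finset
open Summit.PneNP.PneNP.Theorems.AeaCutRectanglesDutyRectangles
open Summit.PneNP.PneNP.Theorems.AeaCutRectanglesDutyTransport
open Summit.PneNP.PneNP.Theorems.AeaCutRectanglesSparseWitnesses
open Summit.PneNP.PneNP.Theorems.AeaCutRectanglesNoSparseSupports
open Summit.PneNP.PneNP.Theorems.AeaCutRectanglesCriticalSupport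
open Summit.PneNP.PneNP.Theorems.FoolingMeasure.Negative

/-! ### §0  Vocabulary shared with g12 (`ImpliedAtomCore.lean`, restated so that this file builds on Theorems only) -/

/-- 3-colourability of the graph of an edge set over `Fin n`. -/
abbrev Col3 {n : ℕ} (G : Finset (Sym2 (Fin n))) : Prop :=
  (SimpleGraph.fromEdgeSet (G : Set (Sym2 (Fin n)))).Colorable 3

/-- X1's rectangle clause at the cut `B` with bound `δ` (the three hypotheses of the crux verbatim). -/
def RectClause {V : Type*} [Fintype V] [DecidableEq V] (μ : Finset (Sym2 V) → ℝ) (B : Finset V) (δ : ℝ) :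
    Prop :=
  ∀ 𝓐 𝓑 : Finset (Finset (Sym2 V)),
    (∀ α ∈ 𝓐, ∀ e ∈ α, ¬ e.IsDiag ∧ ∃ v ∈ e, v ∉ B) →
    (∀ β ∈ 𝓑, ∀ e ∈ β, ¬ e.IsDiag ∧ ∀ v ∈ e, v ∈ B) →
    (∀ α ∈ 𝓐, ∀ β ∈ 𝓑,
      ¬ (SimpleGraph.fromEdgeSet ((α ∪ β : Finset (Sym2 V)) : Set (Sym2 V))).Colorable 3) →
    ∑ q ∈ 𝓐 ×ˢ 𝓑, μ (q.1 ∪ q.2) ≤ δ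

/-- From X1: for every `C` and `N` some `n ≥ N`, `n ≥ 2`, carries a measure satisfying the clause with bound
`2^{-(n/2)·log₂ n - C·n}` at every cut of size `⌈n/2⌉` (those cuts lie in X1's window once `ε·n ≥ 1`).  [g12] -/
theorem foolingMeasure_schedule (hX1 : Summit.PneNP.PneNP.Theses.AeaCutRectangles.FoolingMeasure) (C N : ℕ) :
    ∃ n, N ≤ n ∧ 2 ≤ n ∧ ∃ μ : Finset (Sym2 (Fin n)) → ℝ, (∀ S, 0 ≤ μ S) ∧ (∑ S, μ S = 1) ∧
      (∀ S, μ S ≠ 0 → (∀ e ∈ S, ¬ e.IsDiag) ∧ ¬ Col3 S) ∧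
      ∀ B : Finset (Fin n), n ≤ 2 * B.card → 2 * B.card ≤ n + 1 →
        RectClause μ B ((2 : ℝ) ^ (-((n : ℝ) / 2 * Real.logb 2 n) - ((C : ℕ) : ℝ) * n)) := by
  obtain ⟨ε, hε0, -, hC⟩ := hX1
  obtain ⟨N₀, hN₀⟩ := exists_nat_gt (1 / ε)
  obtain ⟨n, hnN, μ, hμ, hsum, hs, hX⟩ := Filter.frequently_atTop.1 (hC C) (N₀ + N + 2)
  have hnε : (1 : ℝ) ≤ ε * n := by
    have hNn : (N₀ : ℝ) ≤ n := by exact_mod_cast (show N₀ ≤ n by omega)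
    have h := mul_le_mul_of_nonneg_left hNn hε0.le
    have h' : 1 < ε * N₀ := by
      rw [div_lt_iff₀ hε0] at hN₀
      linarith
    linarith
  refine ⟨n, by omega, by omega, μ, hμ, hsum, hs, fun B h1 h2 => ?_⟩
  have h1' : (n : ℝ) ≤ 2 * (B.card : ℝ) := by exact_mod_cast h1
  have h2' : 2 * (B.card : ℝ) ≤ n + 1 := by exact_mod_cast h2
  exact hX B (by nlinarith) (by nlinarith)

/-! ### §1  Bisection-robust critical edge sets; type bounds -/

/-- A BISECTION-ROBUST 4-edge-critical edge set over `Fin n`: edge-critical (loopless, not 3-colourable, every single-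
edge deletion 3-colourable) and every vertex set of size `≥ n/2` spans MORE than `n/2` of its edges (no half-sparse
near-half — exactly the graphs on which the `HalfSparseCore` rectangles have no grip). -/
def BisectionRobustCritical {n : ℕ} (F : Finset (Sym2 (Fin n))) : Prop :=
  IsEdgeCritical F ∧ ∀ S : Finset (Fin n), n ≤ 2 * S.card → n < 2 * (bobSide S F).card

/-- **ROBUST TYPE BOUND** `T`: for every `n` a list of at most `T n` edge sets over `Fin n` contains every bisection-
robust 4-edge-critical edge set up to relabelling.  (`T n` bounds the number of isomorphism types of bisection-robust
4-critical graphs on `n` labelled-but-relabelable vertices.)  OPEN for every `T n = 2^{O(n)}`; consistent with everything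
known (the known robust graphs are circulants: `≤ 2^n` types). -/
def RobustTypeBound (T : ℕ → ℕ) : Prop :=
  ∀ n : ℕ, ∃ 𝓣 : Finset (Finset (Sym2 (Fin n))), 𝓣.card ≤ T n ∧
    ∀ F : Finset (Sym2 (Fin n)), BisectionRobustCritical F →
      ∃ H ∈ 𝓣, ∃ σ : Equiv.Perm (Fin n), F = relabel σ H

/-- `RobustTypeBound` is monotone in the bound. -/
theorem RobustTypeBound.mono {T T' : ℕ → ℕ} (h : ∀ n, T n ≤ T' n) (hT : RobustTypeBound T) :
    RobustTypeBound T' := by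
  intro n
  obtain ⟨𝓣, hc, hcov⟩ := hT n
  exact ⟨𝓣, hc.trans (h n), hcov⟩

/-- A non-3-colourable sub-edge-set of an edge-critical set is the whole set. -/
theorem eq_of_subset_critical {n : ℕ} {F T : Finset (Sym2 (Fin n))} (hT : IsEdgeCritical T) (hFT : F ⊆ T)
    (hF : ¬ Col3 F) : F = T := by
  by_contra hne
  exact hF (hT.colorable_of_ssubset (Finset.ssubset_iff_subset_ne.2 ⟨hFT, hne⟩))

/-- **`HalfSparseCore` is the case `T = 0`.**  Under `HalfSparseCore` there are no bisection-robust 4-critical edge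
sets at all, so the empty list works: the present theorem generalises `foolingMeasure_false_of_halfSparseCore`. -/
theorem robustTypeBound_zero_of_halfSparseCore (hH : HalfSparseCore) : RobustTypeBound (fun _ => 0) := by
  intro n
  refine ⟨∅, le_rfl, fun F hF => ?_⟩
  exfalso
  obtain ⟨hcrit, hrob⟩ := hF
  obtain ⟨S, hS, F', hF'F, hF', hcard⟩ := hH n F hcrit.1 hcrit.2.1
  have hEq : F' = F := eq_of_subset_critical hcrit hF'F hF'
  rw [hEq] at hcard
  have := hrob S hS
  omega

/-! ### §2  Type duties: Bob's side of a relabelled graph is read off the restriction of the relabelling -/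

section TypeDuties

variable {n : ℕ}

/-- Extension of a map `B → Fin n` to `Fin n` (identity off `B`). -/
def ext (B : Finset (Fin n)) (φ : B → Fin n) : Fin n → Fin n :=
  fun v => if h : v ∈ B then φ ⟨v, h⟩ else v

theorem ext_apply_mem (B : Finset (Fin n)) (φ : B → Fin n) {v : Fin n} (hv : v ∈ B) :
    ext B φ v = φ ⟨v, hv⟩ := by
  simp [ext, hv]

/-- The TYPE DUTY datum: the pairs inside `B` whose pull-back under (the extension of) `φ` is an edge of `H`. -/
def typeBob (B : Finset (Fin n)) (H : Finset (Sym2 (Fin n))) (φ : B → Fin n) : Finset (Sym2 (Fin n)) :=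
  univ.filter fun e => (∀ v ∈ e, v ∈ B) ∧ Sym2.map (ext B φ) e ∈ H

/-- **Bob's side of a relabelled graph depends only on the restriction of `σ⁻¹` to `B`.** -/
theorem bobSide_relabel_eq_typeBob (B : Finset (Fin n)) (H : Finset (Sym2 (Fin n))) (σ : Equiv.Perm (Fin n)) :
    bobSide B (relabel σ H) = typeBob B H (fun x => σ.symm x.1) := by
  ext e
  rw [mem_bobSide, typeBob, mem_filter]
  constructor
  · rintro ⟨he, hin⟩
    refine ⟨mem_univ _, hin, ?_⟩
    obtain ⟨e', he', rfl⟩ := mem_relabel.1 he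
    have hmap : Sym2.map (ext B fun x => σ.symm x.1) (Sym2.map σ e') = e' := by
      rw [Sym2.map_map]
      calc Sym2.map ((ext B fun x => σ.symm x.1) ∘ σ) e' = Sym2.map (fun x => x) e' := by
            apply Sym2.map_congr
            intro x hx
            have hσx : σ x ∈ B := hin (σ x) (Sym2.mem_map.2 ⟨x, hx, rfl⟩)
            simp [Function.comp, ext_apply_mem B _ hσx]
        _ = e' := congrFun Sym2.map_id' e'
    rw [hmap]
    exact he'
  · rintro ⟨-, hin, hH⟩
    refine ⟨mem_relabel.2 ⟨Sym2.map (ext B fun x => σ.symm x.1) e, hH, ?_⟩, hin⟩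
    rw [Sym2.map_map]
    calc Sym2.map (σ ∘ ext B fun x => σ.symm x.1) e = Sym2.map (fun x => x) e := by
          apply Sym2.map_congr
          intro x hx
          simp [Function.comp, ext_apply_mem B _ (hin x hx)]
      _ = e := congrFun Sym2.map_id' e

/-- The type duties of a list `𝓣` at the cut `B`: the pairs `(B, typeBob B H φ)`, `H ∈ 𝓣`, `φ : B → Fin n`. -/
noncomputable def typeDuties (B : Finset (Fin n)) (𝓣 : Finset (Finset (Sym2 (Fin n)))) :
    Finset (Finset (Fin n) × Finset (Sym2 (Fin n))) :=
  (𝓣 ×ˢ (univ : Finset (B → Fin n))).image fun p => (B, typeBob B p.1 p.2)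

/-- **Count.**  `#typeDuties B 𝓣 ≤ |𝓣| · n^{|B|}`. -/
theorem card_typeDuties_le (B : Finset (Fin n)) (𝓣 : Finset (Finset (Sym2 (Fin n)))) :
    (typeDuties B 𝓣).card ≤ 𝓣.card * n ^ B.card := by
  classical
  calc (typeDuties B 𝓣).card ≤ (𝓣 ×ˢ (univ : Finset (B → Fin n))).card := card_image_le
    _ = 𝓣.card * n ^ B.card := by
        rw [card_product, card_univ, Fintype.card_fun, Fintype.card_coe, Fintype.card_fin]

/-- Membership: the duty of a robust member `relabel σ H`, `H ∈ 𝓣`, at `B` is a type duty. -/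
theorem mem_typeDuties {B : Finset (Fin n)} {𝓣 : Finset (Finset (Sym2 (Fin n)))} {H : Finset (Sym2 (Fin n))}
    (hH : H ∈ 𝓣) (σ : Equiv.Perm (Fin n)) :
    (B, bobSide B (relabel σ H)) ∈ typeDuties B 𝓣 := by
  classical
  rw [typeDuties, mem_image]
  exact ⟨(H, fun x => σ.symm x.1), mem_product.2 ⟨hH, mem_univ _⟩,
    by rw [bobSide_relabel_eq_typeBob]⟩

end TypeDuties

/-! ### §3  The finite core: the mixed duty cover (half-sparse cores ∪ robust types) -/

/-- **Mixed cover bound.**  `n ≥ 2`; `μ` a probability measure on loopless non-3-colourable edge sets over `Fin n`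
obeying X1's clause with bound `δ` at every cut of size `⌈n/2⌉`; `𝓣` a list containing every bisection-robust
4-edge-critical edge set up to relabelling.  Then
`1 ≤ (2^n · (n/2+1)·C(|Sym2 (Fin n)|, n/2) + |𝓣| · n^{⌈n/2⌉}) · δ`. -/
theorem one_le_cover_bound {n : ℕ} (hn : 2 ≤ n) (μ : Finset (Sym2 (Fin n)) → ℝ)
    (hμ : ∀ S, 0 ≤ μ S) (hsum : ∑ S, μ S = 1)
    (hs : ∀ S, μ S ≠ 0 → (∀ e ∈ S, ¬ e.IsDiag) ∧ ¬ Col3 S)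
    {δ : ℝ} (hδ : 0 ≤ δ)
    (hX : ∀ B : Finset (Fin n), n ≤ 2 * B.card → 2 * B.card ≤ n + 1 → RectClause μ B δ)
    (𝓣 : Finset (Finset (Sym2 (Fin n))))
    (h𝓣 : ∀ F : Finset (Sym2 (Fin n)), BisectionRobustCritical F → ∃ H ∈ 𝓣, ∃ σ : Equiv.Perm (Fin n),
      F = relabel σ H) :
    (1 : ℝ) ≤ ((((2 ^ n * ((n / 2 + 1) * (Fintype.card (Sym2 (Fin n))).choose (n / 2))) : ℕ) : ℝ) +
      ((𝓣.card * n ^ ((n + 1) / 2) : ℕ) : ℝ)) * δ := by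
  classical
  set m : ℕ := n / 2 with hm
  set h : ℕ := (n + 1) / 2 with hh
  -- a fixed cut B⋆ of size ⌈n/2⌉
  obtain ⟨Bstar, -, hBcard⟩ := Finset.exists_subset_card_eq (s := (univ : Finset (Fin n)))
    (show h ≤ (univ : Finset (Fin n)).card by rw [card_univ, Fintype.card_fin]; omega)
  have hB1 : n ≤ 2 * Bstar.card := by rw [hBcard]; omega
  have hB2 : 2 * Bstar.card ≤ n + 1 := by rw [hBcard]; omega
  -- the dictionary
  set P : Finset (Finset (Sym2 (Fin n))) := univ.filter (fun K => K.card ≤ m) with hP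
  set Wset : Finset (Finset (Fin n)) := univ.filter (fun B => n ≤ 2 * B.card ∧ 2 * B.card ≤ n + 1) with hW
  set I : Finset (Finset (Fin n) × Finset (Sym2 (Fin n))) := Wset ×ˢ P ∪ typeDuties Bstar 𝓣 with hI
  -- the cover predicate (Bob-superset rectangles, as in `total_le_of_halfSparseCore`)
  let p : Finset (Fin n) × Finset (Sym2 (Fin n)) → Finset (Sym2 (Fin n)) → Prop := fun q S =>
    q.2 ⊆ bobSide q.1 S ∧ ¬ Col3 (aliceSide q.1 S ∪ q.2)
  have hcov : ∀ S, μ S ≠ 0 → ∃ q ∈ I, p q S := by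
    intro S hS
    obtain ⟨hl, hc⟩ := hs S hS
    have hF := core_critical S hl hc
    have hFS := core_subset S
    set F := core S with hFdef
    by_cases hrob : ∀ S' : Finset (Fin n), n ≤ 2 * S'.card → n < 2 * (bobSide S' F).card
    · -- robust: a type duty at B⋆
      obtain ⟨H, hH, σ, hFeq⟩ := h𝓣 F ⟨hF, hrob⟩
      refine ⟨(Bstar, bobSide Bstar F), ?_, ?_, ?_⟩
      · rw [hI, mem_union]
        right
        rw [hFeq]
        exact mem_typeDuties hH σ
      · exact bobSide_mono Bstar hFS
      · exact not_colorable_of_subset (subset_aliceSide_union_bobSide Bstar hFS) hF.2.1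
    · -- a half-sparse near-half: a `HalfSparseCore` duty
      push Not at hrob
      obtain ⟨S', hS', hcard⟩ := hrob
      obtain ⟨B, hBS', hBc⟩ := exists_subset_card_eq (show h ≤ S'.card by omega)
      have hle : (bobSide B F).card ≤ m := by
        have := card_le_card (bobSide_mono_left hBS' F)
        omega
      refine ⟨(B, bobSide B F), ?_, ?_, ?_⟩
      · rw [hI, mem_union]
        left
        refine mem_product.2 ⟨mem_filter.2 ⟨mem_univ _, ?_, ?_⟩, mem_filter.2 ⟨mem_univ _, hle⟩⟩
        · rw [hBc]; omega
        · rw [hBc]; omega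
      · exact bobSide_mono B hFS
      · exact not_colorable_of_subset (subset_aliceSide_union_bobSide B hFS) hF.2.1
  -- every duty of the dictionary sits at a cut of size ⌈n/2⌉
  have hcut : ∀ q ∈ I, n ≤ 2 * q.1.card ∧ 2 * q.1.card ≤ n + 1 := by
    intro q hq
    rw [hI, mem_union] at hq
    rcases hq with hq | hq
    · obtain ⟨hB, -⟩ := mem_product.1 hq
      exact (mem_filter.1 hB).2
    · rw [typeDuties, mem_image] at hq
      obtain ⟨p', -, rfl⟩ := hq
      exact ⟨hB1, hB2⟩
  -- union bound
  have htot : ∑ S, μ S ≤ (I.card : ℝ) * δ := by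
    calc ∑ S, μ S ≤ ∑ q ∈ I, ∑ S ∈ univ.filter (p q), μ S := sum_le_sum_cover I p μ hμ hcov
      _ ≤ ∑ _q ∈ I, δ := by
          refine sum_le_sum fun q hq => ?_
          obtain ⟨h1, h2⟩ := hcut q hq
          exact bobSupset_le_of_rectClause μ hμ hs (hX q.1 h1 h2) q.2 _
            (fun G hG _ => (mem_filter.1 hG).2)
      _ = (I.card : ℝ) * δ := by rw [sum_const, nsmul_eq_mul]
  rw [hsum] at htot
  -- count
  have hIcard : I.card ≤ 2 ^ n * ((n / 2 + 1) * (Fintype.card (Sym2 (Fin n))).choose (n / 2)) +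
      𝓣.card * n ^ ((n + 1) / 2) := by
    have hWc : Wset.card ≤ 2 ^ n := by
      calc Wset.card ≤ (univ : Finset (Finset (Fin n))).card := card_le_card (filter_subset _ _)
        _ = 2 ^ n := by rw [card_univ, Fintype.card_finset, Fintype.card_fin]
    have hPc : P.card ≤ (n / 2 + 1) * (Fintype.card (Sym2 (Fin n))).choose (n / 2) :=
      card_filter_card_le_choose (Sym2 (Fin n)) m
        ((show 2 * m ≤ n by omega).trans (le_card_sym2_fin (by omega)))
    have hTc := card_typeDuties_le Bstar 𝓣
    rw [hBcard] at hTc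
    calc I.card ≤ (Wset ×ˢ P).card + (typeDuties Bstar 𝓣).card := card_union_le _ _
      _ ≤ 2 ^ n * ((n / 2 + 1) * (Fintype.card (Sym2 (Fin n))).choose (n / 2)) +
          𝓣.card * n ^ ((n + 1) / 2) := by
          rw [card_product]
          exact Nat.add_le_add (Nat.mul_le_mul hWc hPc) hTc
  have hIcardR : (I.card : ℝ) ≤ ((((2 ^ n * ((n / 2 + 1) * (Fintype.card (Sym2 (Fin n))).choose (n / 2))) :
      ℕ) : ℝ) + ((𝓣.card * n ^ ((n + 1) / 2) : ℕ) : ℝ)) := by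
    exact_mod_cast hIcard
  have := mul_le_mul_of_nonneg_right hIcardR hδ
  linarith

/-! ### §4  Threshold arithmetic and the conditional refutation -/

/-- The X1 budget at `C` splits off the budget at `4`:  `δ_C = δ_4 · 2^{-(C-4)·n}` for `C ≥ 4`. -/
theorem delta_split {n C : ℕ} (hC : 4 ≤ C) :
    (2 : ℝ) ^ (-((n : ℝ) / 2 * Real.logb 2 n) - ((C : ℕ) : ℝ) * n) =
      (2 : ℝ) ^ (-((n : ℝ) / 2 * Real.logb 2 n) - ((4 : ℕ) : ℝ) * n) * ((2 : ℝ) ^ ((C - 4) * n))⁻¹ := by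
  have hC' : ((C : ℕ) : ℝ) = ((4 : ℕ) : ℝ) + ((C - 4 : ℕ) : ℝ) := by
    rw [← Nat.cast_add]; congr 1; omega
  rw [hC', add_mul, ← sub_sub, Real.rpow_sub (by norm_num) _ (((C - 4 : ℕ) : ℝ) * n)]
  rw [div_eq_mul_inv]
  congr 2
  rw [show ((C - 4 : ℕ) : ℝ) * (n : ℝ) = (((C - 4) * n : ℕ) : ℝ) by push_cast; ring, Real.rpow_natCast]

/-- The X1 budget at `C` as `n^{-n/2} · 2^{-C n}`. -/
theorem delta_eq {n C : ℕ} (hn : 1 ≤ n) :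
    (2 : ℝ) ^ (-((n : ℝ) / 2 * Real.logb 2 n) - ((C : ℕ) : ℝ) * n) =
      ((n : ℝ) ^ ((n : ℝ) / 2))⁻¹ * ((2 : ℝ) ^ (C * n))⁻¹ := by
  rw [Real.rpow_sub (by norm_num), Real.rpow_neg (by norm_num), two_rpow_half_logb hn, div_eq_mul_inv]
  congr 2
  rw [show ((C : ℕ) : ℝ) * (n : ℝ) = ((C * n : ℕ) : ℝ) by push_cast; ring, Real.rpow_natCast]

/-- `n^{⌈n/2⌉} ≤ n · n^{n/2}` (real exponent on the right). -/
theorem pow_ceil_half_le {n : ℕ} (hn : 1 ≤ n) :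
    ((n ^ ((n + 1) / 2) : ℕ) : ℝ) ≤ (n : ℝ) * (n : ℝ) ^ ((n : ℝ) / 2) := by
  have hn1 : (1 : ℝ) ≤ n := by exact_mod_cast hn
  have hn0 : (0 : ℝ) < n := by linarith
  push_cast
  rw [← Real.rpow_natCast]
  calc (n : ℝ) ^ ((((n + 1) / 2 : ℕ)) : ℝ) ≤ (n : ℝ) ^ (1 + (n : ℝ) / 2) := by
        apply Real.rpow_le_rpow_of_exponent_le hn1
        have : (2 * ((n + 1) / 2 : ℕ) : ℝ) ≤ n + 1 := by exact_mod_cast (show 2 * ((n + 1) / 2) ≤ n + 1 by omega)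
        linarith
    _ = (n : ℝ) * (n : ℝ) ^ ((n : ℝ) / 2) := by
        rw [Real.rpow_add hn0, Real.rpow_one]

/-- **The type count beats the threshold.**  `|𝓣| ≤ 2^{κ n}` and `C = κ + 5` give `|𝓣|·n^{⌈n/2⌉}·δ_C ≤ 1/16`. -/
theorem type_term_le {n κ T : ℕ} (hn : 1 ≤ n) (hT : T ≤ 2 ^ (κ * n)) :
    ((T * n ^ ((n + 1) / 2) : ℕ) : ℝ) * (2 : ℝ) ^ (-((n : ℝ) / 2 * Real.logb 2 n) - ((κ + 5 : ℕ) : ℝ) * n)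
      ≤ 1 / 16 := by
  have hn1 : (1 : ℝ) ≤ n := by exact_mod_cast hn
  have hn0 : (0 : ℝ) < n := by linarith
  have hA : (0 : ℝ) < (n : ℝ) ^ ((n : ℝ) / 2) := Real.rpow_pos_of_pos hn0 _
  rw [delta_eq hn]
  have hTR : ((T : ℕ) : ℝ) ≤ (2 : ℝ) ^ (κ * n) := by exact_mod_cast hT
  have hpow := pow_ceil_half_le hn
  -- |𝓣|·n^{⌈n/2⌉} ≤ 2^{κn} · n · n^{n/2}
  have hnum : ((T * n ^ ((n + 1) / 2) : ℕ) : ℝ) ≤ (2 : ℝ) ^ (κ * n) * ((n : ℝ) * (n : ℝ) ^ ((n : ℝ) / 2)) := by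
    push_cast
    have h1 : ((T : ℕ) : ℝ) * ((n : ℝ) ^ ((n + 1) / 2)) ≤ (2 : ℝ) ^ (κ * n) * ((n : ℝ) ^ ((n + 1) / 2)) :=
      mul_le_mul_of_nonneg_right hTR (by positivity)
    have h2 : (2 : ℝ) ^ (κ * n) * ((n : ℝ) ^ ((n + 1) / 2)) ≤
        (2 : ℝ) ^ (κ * n) * ((n : ℝ) * (n : ℝ) ^ ((n : ℝ) / 2)) := by
      apply mul_le_mul_of_nonneg_left _ (by positivity)
      exact_mod_cast hpow
    exact h1.trans h2
  -- n ≤ 2^n, and 2^{(κ+5)n} = 2^{κn} · 2^n · 16^n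
  have hn2 : (n : ℝ) ≤ (2 : ℝ) ^ n := by exact_mod_cast Nat.lt_two_pow_self.le
  have h16 : (16 : ℝ) ≤ (16 : ℝ) ^ n := by
    calc (16 : ℝ) = 16 ^ 1 := by norm_num
      _ ≤ 16 ^ n := pow_le_pow_right₀ (by norm_num) hn
  have hsplit : (2 : ℝ) ^ ((κ + 5) * n) = (2 : ℝ) ^ (κ * n) * (2 : ℝ) ^ n * (16 : ℝ) ^ n := by
    rw [show (κ + 5) * n = κ * n + n + 4 * n by ring, pow_add, pow_add,
      show (2 : ℝ) ^ (4 * n) = 16 ^ n by rw [pow_mul]; norm_num]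
  calc ((T * n ^ ((n + 1) / 2) : ℕ) : ℝ) * (((n : ℝ) ^ ((n : ℝ) / 2))⁻¹ * ((2 : ℝ) ^ ((κ + 5) * n))⁻¹)
      ≤ (2 : ℝ) ^ (κ * n) * ((n : ℝ) * (n : ℝ) ^ ((n : ℝ) / 2)) *
          (((n : ℝ) ^ ((n : ℝ) / 2))⁻¹ * ((2 : ℝ) ^ ((κ + 5) * n))⁻¹) :=
        mul_le_mul_of_nonneg_right hnum (by positivity)
    _ = (n : ℝ) / ((2 : ℝ) ^ n * (16 : ℝ) ^ n) := by
        rw [hsplit]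
        have hA' : (n : ℝ) ^ ((n : ℝ) / 2) ≠ 0 := hA.ne'
        field_simp
    _ ≤ (2 : ℝ) ^ n / ((2 : ℝ) ^ n * (16 : ℝ) ^ n) := by
        gcongr
    _ = 1 / (16 : ℝ) ^ n := by
        field_simp
    _ ≤ 1 / 16 := by
        gcongr

/-- **X1 IS FALSE IF BISECTION-ROBUST 4-CRITICAL GRAPHS COME IN FEW TYPES.**  If some list of `≤ T n` edge sets over
`Fin n` contains every bisection-robust 4-edge-critical edge set up to relabelling (`RobustTypeBound T`) and
`T n ≤ 2^{κ n}` for all large `n`, then `Summit.PneNP.PneNP.Theses.AeaCutRectangles.FoolingMeasure` fails: at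
`C = κ + 5` the mixed duty cover (`one_le_cover_bound`) has total weight `< 2^{-n} + 1/16 < 1`. -/
theorem foolingMeasure_false_of_fewRobustTypes {T : ℕ → ℕ} (hT : RobustTypeBound T) {κ : ℕ}
    (hκ : ∀ᶠ n in Filter.atTop, T n ≤ 2 ^ (κ * n)) :
    ¬ Summit.PneNP.PneNP.Theses.AeaCutRectangles.FoolingMeasure := by
  intro hX1
  obtain ⟨N, hN⟩ := Filter.eventually_atTop.1 hκ
  obtain ⟨n, hnN, hn2, μ, hμ, hsum, hs, hX⟩ := foolingMeasure_schedule hX1 (κ + 5) N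
  obtain ⟨𝓣, h𝓣card, h𝓣⟩ := hT n
  set δ : ℝ := (2 : ℝ) ^ (-((n : ℝ) / 2 * Real.logb 2 n) - ((κ + 5 : ℕ) : ℝ) * n) with hδ
  have hδpos : 0 < δ := Real.rpow_pos_of_pos (by norm_num) _
  have hcore := one_le_cover_bound hn2 μ hμ hsum hs hδpos.le hX 𝓣 h𝓣
  -- the half-sparse term: (2^n·(n/2+1)·C(N,n/2))·δ_C = (… · δ_4) · 2^{-(κ+1)n} ≤ 1 · 1/2
  have hsparse : (((2 ^ n * ((n / 2 + 1) * (Fintype.card (Sym2 (Fin n))).choose (n / 2))) : ℕ) : ℝ) * δ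
      ≤ 1 / 2 := by
    have hlt := halfSparse_count_lt_one hn2
    have hsplit := @delta_split n (κ + 5) (by omega)
    have hE : (2 : ℝ) ≤ (2 : ℝ) ^ ((κ + 5 - 4) * n) := by
      have h1 : 1 ≤ (κ + 5 - 4) * n := by
        calc 1 = 1 * 1 := rfl
          _ ≤ (κ + 5 - 4) * n := Nat.mul_le_mul (by omega) (by omega)
      calc (2 : ℝ) = 2 ^ 1 := by norm_num
        _ ≤ 2 ^ ((κ + 5 - 4) * n) := pow_le_pow_right₀ (by norm_num) h1
    have hEpos : (0 : ℝ) < (2 : ℝ) ^ ((κ + 5 - 4) * n) := by positivity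
    have hcast : (((2 ^ n * ((n / 2 + 1) * (Fintype.card (Sym2 (Fin n))).choose (n / 2))) : ℕ) : ℝ) =
        ((2 ^ n : ℕ) : ℝ) * ((((n / 2 + 1) * (Fintype.card (Sym2 (Fin n))).choose (n / 2)) : ℕ) : ℝ) := by
      push_cast; ring
    have hA4 : (((2 ^ n * ((n / 2 + 1) * (Fintype.card (Sym2 (Fin n))).choose (n / 2))) : ℕ) : ℝ) *
        (2 : ℝ) ^ (-((n : ℝ) / 2 * Real.logb 2 n) - ((4 : ℕ) : ℝ) * n) < 1 := by
      rw [hcast, mul_assoc]; exact hlt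
    calc (((2 ^ n * ((n / 2 + 1) * (Fintype.card (Sym2 (Fin n))).choose (n / 2))) : ℕ) : ℝ) * δ
        = ((((2 ^ n * ((n / 2 + 1) * (Fintype.card (Sym2 (Fin n))).choose (n / 2))) : ℕ) : ℝ) *
            (2 : ℝ) ^ (-((n : ℝ) / 2 * Real.logb 2 n) - ((4 : ℕ) : ℝ) * n)) *
            ((2 : ℝ) ^ ((κ + 5 - 4) * n))⁻¹ := by rw [hδ, hsplit]; ring
      _ ≤ 1 * (2 : ℝ)⁻¹ :=
          mul_le_mul hA4.le (inv_anti₀ (by norm_num) hE) (inv_nonneg.2 hEpos.le) zero_le_one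
      _ = 1 / 2 := by norm_num
  have htype : ((𝓣.card * n ^ ((n + 1) / 2) : ℕ) : ℝ) * δ ≤ 1 / 16 :=
    type_term_le (by omega) (h𝓣card.trans (hN n hnN))
  have hsum' : ((((2 ^ n * ((n / 2 + 1) * (Fintype.card (Sym2 (Fin n))).choose (n / 2))) : ℕ) : ℝ) +
          ((𝓣.card * n ^ ((n + 1) / 2) : ℕ) : ℝ)) * δ =
        (((2 ^ n * ((n / 2 + 1) * (Fintype.card (Sym2 (Fin n))).choose (n / 2))) : ℕ) : ℝ) * δ +
          ((𝓣.card * n ^ ((n + 1) / 2) : ℕ) : ℝ) * δ := by ring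
  rw [hsum'] at hcore
  linarith

/-- **Kill path (stmt-PneNP-19729) under FEW ROBUST TYPES.** -/
theorem noFoolingMeasure_of_fewRobustTypes {T : ℕ → ℕ} (hT : RobustTypeBound T) {κ : ℕ}
    (hκ : ∀ᶠ n in Filter.atTop, T n ≤ 2 ^ (κ * n)) :
    Summit.PneNP.PneNP.Theses.AeaCutRectangles.NoFoolingMeasure := by
  unfold Summit.PneNP.PneNP.Theses.AeaCutRectangles.NoFoolingMeasure
  exact foolingMeasure_false_of_fewRobustTypes hT hκ

/-- The g2 conditional kill recovered as the case `T = 0`. -/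
theorem foolingMeasure_false_of_halfSparseCore' (hH : HalfSparseCore) :
    ¬ Summit.PneNP.PneNP.Theses.AeaCutRectangles.FoolingMeasure :=
  foolingMeasure_false_of_fewRobustTypes (robustTypeBound_zero_of_halfSparseCore hH) (κ := 0)
    (Filter.Eventually.of_forall fun n => by simp)

/-- **The construct side's burden, as a theorem.**  X1 forces, for every `κ`, infinitely many `n` such that NO list of
`≤ 2^{κ n}` edge sets over `Fin n` contains all bisection-robust 4-edge-critical edge sets up to relabelling — i.e.
more than `2^{κ n}` pairwise non-isomorphic bisection-robust 4-critical graphs on `n` vertices. -/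
theorem foolingMeasure_imp_manyRobustTypes (hX1 : Summit.PneNP.PneNP.Theses.AeaCutRectangles.FoolingMeasure)
    (κ : ℕ) : ∃ᶠ n in Filter.atTop, ∀ 𝓣 : Finset (Finset (Sym2 (Fin n))), 𝓣.card ≤ 2 ^ (κ * n) →
      ∃ F : Finset (Sym2 (Fin n)), BisectionRobustCritical F ∧ ∀ H ∈ 𝓣, ∀ σ : Equiv.Perm (Fin n),
        F ≠ relabel σ H := by
  classical
  rw [Filter.frequently_atTop]
  intro N
  by_contra hcon
  push Not at hcon
  -- for every n ≥ N a small covering list exists; below N take the full list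
  let T : ℕ → ℕ := fun n => if N ≤ n then 2 ^ (κ * n) else Fintype.card (Finset (Sym2 (Fin n)))
  have hT : RobustTypeBound T := by
    intro n
    by_cases hn : N ≤ n
    · obtain ⟨𝓣, hc, hall⟩ := hcon n hn
      refine ⟨𝓣, by simp [T, hn, hc], fun F hF => ?_⟩
      by_contra hno
      push Not at hno
      obtain ⟨H, hH, σ, hEq⟩ := (hall F hF)
      exact hno H hH σ hEq
    · refine ⟨univ, by simp [T, hn], fun F _ => ⟨F, mem_univ _, Equiv.refl _, ?_⟩⟩
      ext e
      simp [relabel]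
  have hκ : ∀ᶠ n in Filter.atTop, T n ≤ 2 ^ (κ * n) :=
    Filter.eventually_atTop.2 ⟨N, fun n hn => by simp [T, hn]⟩
  exact foolingMeasure_false_of_fewRobustTypes hT hκ hX1

/-! ### §5  Erratum lemma: normal cycle systems are never one-sided -/

section Erratum

open Summit.PneNP.PneNP.Cruxes.FoolingMeasure.IdeasR2g3

variable {q t : ℕ}

/-- The graph of a cycle system on `3q+1 ≥ 4` points is loopless. -/
theorem CycleSystem.edges_loopless (S : CycleSystem q t) (hq : 1 ≤ q) :
    ∀ e ∈ S.edges, ¬ e.IsDiag := by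
  classical
  intro e he
  simp only [CycleSystem.edges, mem_image, mem_univ, true_and] at he
  obtain ⟨⟨k, v⟩, rfl⟩ := he
  rw [Sym2.mk_isDiag_iff]
  intro h
  have h1 := S.pos_succ k v
  rw [← h] at h1
  -- `pos k v = pos k v + 1` in `Fin (3q+1)` forces `1 = 0`, i.e. `3q = 0`
  have h2 : (1 : Fin (3 * q + 1)) = 0 := add_left_cancel (h1.symm.trans (add_zero _).symm)
  have h3 := Fin.one_eq_zero_iff.1 h2
  omega

/-- A dark NORMAL cycle system is 4-edge-critical in the tree's vocabulary (`IsEdgeCritical`). -/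
theorem normal_isEdgeCritical (S : CycleSystem q t) (hq : 1 ≤ q) (hN : S.Normal) (h3 : ¬ Col3 S.edges) :
    IsEdgeCritical S.edges :=
  ⟨CycleSystem.edges_loopless S hq, h3, (normal_fourCritical S hq hN h3).2⟩

/-- **ERRATUM LEMMA.**  The Alice side of a dark NORMAL cycle system is 3-colourable at every cut with at least one
system edge inside `B` — so "dark Alice sides at 48–75 % of random bisections" (RESULTS-r2s2g11 §1.4 bis, kit j315246)
cannot occur for `Normal` systems: those measurements were taken on systems violating `CycleSystem.Normal`. -/
theorem normal_aliceSide_colorable (S : CycleSystem q t) (hq : 1 ≤ q) (hN : S.Normal) (h3 : ¬ Col3 S.edges)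
    {B : Finset (Fin (3 * q + 1))} (hB : (bobSide B S.edges).Nonempty) :
    Col3 (aliceSide B S.edges) :=
  (normal_isEdgeCritical S hq hN h3).aliceSide_colorable hB

end Erratum

/-! ### Audit -/

example : RobustTypeBound (fun _ => 0) → Summit.PneNP.PneNP.Theses.AeaCutRectangles.NoFoolingMeasure :=
  fun h => noFoolingMeasure_of_fewRobustTypes h (κ := 0) (Filter.Eventually.of_forall fun n => by simp)

end Summit.PneNP.PneNP.Cruxes.FoolingMeasure.P4g13
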